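import Literature.MathematicalPhysics.QuantumLattice.EmeryThreeBandByDecoration
import Literature.MathematicalPhysics.QuantumLattice.ClusterProductStateEnergy
import HarnessLib

/-!
# The dummy-free `2×2`-periodic class of the decorated three-band (Emery) model is NONEMPTY at every cell filling
# `0 ≤ ρ ≤ 3/2` — and only there: an explicit periodic product state (`⊗_v ρ₀` of a classical cell density matrix)

Topic `Literature/MathematicalPhysics/QuantumLattice` (family `hubbard`; crew hubbard-fast S2 (iv) «three-band Emery boxes»).
Every floor / Lipschitz / cluster law on the typed three-band density `emeryEnergyDensity θ ρ` (`EmeryThreeBandByDecoration`,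
`EmeryThreeBandClusterFloor`, `EmeryThreeBandRingWindowFloor`, the Downfold doors `EmeryClusterFloorSeam`) carries the hypothesis
`(emeryStates ρ).Nonempty` — the variational class (`2×2`-periodic states, EMPTY on the dummy sublattice `(1,1)+2ℤ²`, cell filling `ρ`)
must be inhabited, else the infimum is over the empty set. This file discharges it once and for all:

* §1 `parityAut_diagonal`: a density matrix diagonal in the occupation basis is even (sums against a two-point weight are private helpers).
* §2 `density_shift_rectTilingState_eq` / `_eq_trace`: the translated one-site densities of the rectangular tiling state `⊗_v ρ₀`
  (`FermionRectTilingProductState`) read `Re tr((n_{x↑}+n_{x↓}) ρ₀)` at every cell site `x` (general `d`, `q`);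
  **`rectTilingState_mem_emeryStates`**: an even cell density matrix with NO particle on the dummy site and `Re tr(N ρ₀) = 4ρ` tiles to a
  member of `emeryStates ρ`.
* §3 the witness: `emeryCellWeight λ` = the classical two-point weight `(1−λ)·δ_∅ + λ·δ_T`, `T` = the six physical orbitals of the cell
  (`emeryPhysOrbs`, all orbitals off the dummy site; `card_emeryPhysOrbs = 6`), `emeryCellDensityMatrix λ = diagonal (emeryCellWeight λ)`:
  even, of trace `1`, positive for `0 ≤ λ ≤ 1`, dummy occupation `0`, particle number `6λ`.
* §4 **`emeryStates_nonempty`** (`0 ≤ ρ ≤ 3/2`, with `λ = 2ρ/3`), the converse **`emeryStates_subset_range`** (a member forces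
  `0 ≤ ρ ≤ 3/2`: three physical sites of density `≤ 2`, one empty site, per four lattice sites) and **`emeryStates_nonempty_iff`**;
  the hypothesis-free JOINT LIPSCHITZ law `abs_emeryEnergyDensity_sub_le'` as a sample corollary (every other consumer discharges its
  `hS` by `emeryStates_nonempty hρ0 hρ1`).

Everything is PROVED (0 sorry); definitions with bodies: `emeryPhysOrbs`, `emeryCellWeight`, `emeryCellDensityMatrix`. HONEST SCOPE: an
existence witness only (a deliberately crude classical mixture of the empty and the fully occupied `CuO₂` cell); it certifies no energy.

## Mathlib / tree search

REUSED: `emeryStates`, `liebPeriods`, `dummySite` (`EmeryThreeBandByDecoration`); `rectTilingState`, `rectTilingState_isPeriodic`,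
`rectTilingState_expect_box_zero`, `halfOpenRect`, `mem_halfOpenRect`, `card_halfOpenRect` (`FermionRectTilingProductState`);
`sum_cell_density_rectTilingState_eq` (`ClusterProductStateEnergy`); `density_shift_eq`, `nAt`, `PolySite.pt`, `fermionEmbed_numberOp`,
`density_nonneg`, `density_le_two`, `cellFilling`, `Cell`, `cellPos`; `orbs`, `orb_mem_orbs`, `card_orbs` (`HubbardBondAlgebra`, `RegionalNumberCharge`),
`card_polySite`; `parityAut_apply`, `parityOp`, `numberAt_eq_diagonal`, `numberAt_orb`, `totalNumber_eq_diagonal_card`; Mathlib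
`Matrix.diagonal_mul_diagonal`, `Matrix.trace_diagonal`, `Matrix.posSemidef_diagonal_iff`, `Finset.sum_ite_eq'`.
`lean search 'emeryStates'` (2026-08-28): only the definition and its consumers (all with the nonemptiness HYPOTHESIS); no witness.

## References

* H. Araki, H. Moriya, Rev. Math. Phys. 15 (2003) 93, §4.1 Def. 4.5, §11.1 Thm. 11.2 (periodic product states of even factors).
  [cite: ArakiMoriya2003, §11.1 Theorem 11.2]
* O. Bratteli, D. W. Robinson, *OAQSM 2* (1997), Thm. 6.2.40 (product states over a box tiling). [cite: BratteliRobinsonII1997, Thm. 6.2.40]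
* E. Pavarini et al., Phys. Rev. Lett. 87 (2001) 047003, eq. (1) (the three-band `CuO₂` Hamiltonian). [cite: PavariniEtAl2001, eq. (1)]
-/

noncomputable section

namespace Literature.MathematicalPhysics.QuantumLattice

open Matrix Finset HubbardWave0 Literature.Probability.LatticeModels ThermodynamicLimit
open scoped ComplexOrder BigOperators

/-! ### §1 Classical (occupation-diagonal) density matrices -/

section Diagonal

variable {κ : Type*} [LinearOrder κ] [Fintype κ]

/-- **A matrix diagonal in the occupation basis is even**: `Θ(diag p) = diag p` (`Θ = P·P` with `P = diag (−1)^{|s|}`, `P² = 1`).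
[cite: ArakiMoriya2003, §4.1 Def. 4.2] -/
theorem parityAut_diagonal (p : Finset κ → ℂ) : parityAut (diagonal p) = diagonal p := by
  rw [parityAut_apply, parityOp, diagonal_mul_diagonal, diagonal_mul_diagonal]
  congr 1
  funext s
  rw [mul_assoc, mul_comm (p s), ← mul_assoc, ← mul_pow, neg_mul_neg, one_mul, one_pow, one_mul]

/-- Sums against a two-point weight `a·δ_A + b·δ_B`: `Σ_s f(s)·(a[s=A] + b[s=B]) = a f(A) + b f(B)`. [folklore] -/
private theorem sum_mul_twoPoint (f : Finset κ → ℂ) (a b : ℂ) (A B : Finset κ) :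
    ∑ s, f s * (a * (if s = A then 1 else 0) + b * (if s = B then 1 else 0)) = a * f A + b * f B := by
  simp only [mul_add, Finset.sum_add_distrib, mul_ite, mul_one, mul_zero, Finset.sum_ite_eq', Finset.mem_univ, if_true]
  ring

end Diagonal

/-! ### §2 One-site densities of the rectangular tiling state; the membership criterion for `emeryStates` -/

namespace InfVolFermionState

section TilingDensity

variable {d : ℕ} (q : Fin d → ℕ) (ρ₀ : FermionOp (halfOpenRect q)) (hev : parityAut ρ₀ = ρ₀) (hpsd : ρ₀.PosSemidef) (htr : ρ₀.trace = 1)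

/-- **Translated one-site density of the tiling state**, read on the reference cell: for a cell site `x`,
`ρ((⊗_v ρ₀) ∘ τ_x) = Re ω_{[0,q+1)}(n_{x↑} + n_{x↓})`. [cite: ArakiMoriya2003, §4.1 (number operators)] -/
theorem density_shift_rectTilingState_eq {x : Site d} (hx : x ∈ halfOpenRect q) :
    ((rectTilingState q ρ₀ hev hpsd htr).shift x).density =
      ((rectTilingState q ρ₀ hev hpsd htr).expect (halfOpenRect q) (nAt x hx 0 + nAt x hx 1)).re := by
  set ω := rectTilingState q ρ₀ hev hpsd htr
  rw [density_shift_eq]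
  congr 1
  have hsub : ({0 + x} : Finset (Site d)) ⊆ halfOpenRect q := Finset.singleton_subset_iff.2 (by rw [zero_add]; exact hx)
  rw [← ω.compatible hsub, map_add]
  have h1 : ∀ σ, fermionEmbed (PolySite.incl hsub) (nAt (0 + x) (mem_singleton_self _) σ) = nAt x hx σ := fun σ => by
    rw [nAt, fermionEmbed_numberOp, PolySite.incl_pt, nAt]
    exact congrArg (fun y => numberOp y σ) (Subtype.ext (by simp))
  rw [h1, h1]

/-- **Translated one-site density of the tiling state as a trace**: `ρ((⊗_v ρ₀) ∘ τ_x) = Re tr((n_{x↑} + n_{x↓}) ρ₀)` for every cell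
site `x`. [cite: BratteliRobinsonII1997, Thm. 6.2.40] -/
theorem density_shift_rectTilingState_eq_trace {x : Site d} (hx : x ∈ halfOpenRect q) :
    ((rectTilingState q ρ₀ hev hpsd htr).shift x).density = (((nAt x hx 0 + nAt x hx 1) * ρ₀).trace).re := by
  rw [density_shift_rectTilingState_eq q ρ₀ hev hpsd htr hx, rectTilingState_expect_box_zero]

end TilingDensity

/-- The side vector of the `2×2` cell: `liebPeriods i + 1 = 2`. [cite: ArakiMoriya2003, §4.1 Def. 4.3] -/
theorem liebPeriods_add_one (i : Fin 2) : ((liebPeriods i : ℕ) : ℤ) + 1 = 2 := by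
  fin_cases i <;> simp [liebPeriods]

/-- The dummy site `(1,1)` lies in the reference cell `[0,2)²`. [cite: PavariniEtAl2001, eq. (1)] -/
theorem dummySite_mem_halfOpenRect : dummySite ∈ halfOpenRect liebPeriods := by
  rw [mem_halfOpenRect]
  intro i
  rw [liebPeriods_add_one]
  fin_cases i <;> simp [dummySite, unitVec]

/-- The `2×2` cell has four points (private restatement; the Downfold tree has `card_cell_lieb`). [cite: ArakiMoriya2003, §4.1 Def. 4.3] -/
private theorem card_cell_liebPeriods' : Fintype.card (Cell liebPeriods) = 4 := by
  rw [Fintype.card_pi, Fin.prod_univ_two, Fintype.card_fin, Fintype.card_fin]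
  rfl

/-- The reference cell `[0,2)²` has four sites. [cite: ArakiMoriya2003, §4.1 Def. 4.3] -/
theorem card_halfOpenRect_liebPeriods : #(halfOpenRect liebPeriods) = 4 := by
  rw [card_halfOpenRect, Fin.prod_univ_two]
  rfl

/-- The cell point `(1,1)` sits at the dummy site. [cite: PavariniEtAl2001, eq. (1)] -/
theorem cellPos_dummy : cellPos (fun i => Fin.last (liebPeriods i) : Cell liebPeriods) = dummySite := by
  funext i
  fin_cases i <;> simp [cellPos, dummySite, unitVec, liebPeriods]

/-- **MEMBERSHIP CRITERION.** An even density matrix `ρ₀` on the `2×2` cell with NO particle on the dummy site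
(`Re tr((n_{(1,1)↑}+n_{(1,1)↓}) ρ₀) = 0`) and particle number `Re tr(N ρ₀) = 4ρ` tiles (`⊗_v ρ₀`, `FermionRectTilingProductState`) to a
member of the dummy-free `2×2`-periodic class `emeryStates ρ`. [cite: BratteliRobinsonII1997, Thm. 6.2.40] [cite: ArakiMoriya2003, §11.1 Theorem 11.2] -/
theorem rectTilingState_mem_emeryStates (ρ₀ : FermionOp (halfOpenRect liebPeriods)) (hev : parityAut ρ₀ = ρ₀) (hpsd : ρ₀.PosSemidef)
    (htr : ρ₀.trace = 1) {ρ : ℝ}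
    (hdummy : (((nAt dummySite dummySite_mem_halfOpenRect 0 + nAt dummySite dummySite_mem_halfOpenRect 1) * ρ₀).trace).re = 0)
    (hN : (((totalNumber : FermionOp (halfOpenRect liebPeriods)) * ρ₀).trace).re = 4 * ρ) :
    rectTilingState liebPeriods ρ₀ hev hpsd htr ∈ emeryStates ρ := by
  refine ⟨rectTilingState_isPeriodic _ _ _ _ _, ?_, ?_⟩
  · rw [density_shift_rectTilingState_eq_trace liebPeriods ρ₀ hev hpsd htr dummySite_mem_halfOpenRect, hdummy]
  · rw [InfVolFermionState.cellFilling, sum_cell_density_rectTilingState_eq, hN, card_cell_liebPeriods']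
    push_cast
    ring

end InfVolFermionState

/-! ### §3 The witness: a classical mixture of the empty and the fully occupied `CuO₂` cell -/

section Witness

/-- **The six physical orbitals of the `2×2` cell**: all orbitals off the dummy site `(1,1)` (Cu `(0,0)`, O_x `(1,0)`, O_y `(0,1)`, both spins).
[cite: PavariniEtAl2001, eq. (1)] -/
def emeryPhysOrbs : Finset (Orb (PolySite (halfOpenRect liebPeriods))) :=
  orbs ((Finset.univ : Finset (PolySite (halfOpenRect liebPeriods))).erase
    (PolySite.pt dummySite InfVolFermionState.dummySite_mem_halfOpenRect))

/-- No dummy orbital is physical. [cite: PavariniEtAl2001, eq. (1)] -/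
theorem orb_dummy_notMem_emeryPhysOrbs (σ : Fin 2) :
    orb (PolySite.pt dummySite InfVolFermionState.dummySite_mem_halfOpenRect) σ ∉ emeryPhysOrbs := by
  rw [emeryPhysOrbs, orb_mem_orbs]
  exact Finset.notMem_erase _ _

/-- There are six physical orbitals in the cell (`2 × (4 − 1)`). [cite: PavariniEtAl2001, eq. (1)] -/
theorem card_emeryPhysOrbs : #emeryPhysOrbs = 6 := by
  rw [emeryPhysOrbs, card_orbs, Finset.card_erase_of_mem (Finset.mem_univ _), Finset.card_univ, card_polySite,
    InfVolFermionState.card_halfOpenRect_liebPeriods]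

/-- The physical orbital set is not the empty configuration. [cite: PavariniEtAl2001, eq. (1)] -/
theorem emeryPhysOrbs_ne_empty : emeryPhysOrbs ≠ ∅ := by
  intro h
  have h6 := card_emeryPhysOrbs
  rw [h, Finset.card_empty] at h6
  exact absurd h6 (by norm_num)

/-- **The two-point classical weight** `p_λ = (1−λ)·δ_∅ + λ·δ_T` on occupation configurations of the cell (`T` = the six physical
orbitals): empty cell with probability `1−λ`, fully occupied `CuO₂` unit (dummy empty) with probability `λ`. [cite: ArakiMoriya2003, §4.1 Def. 4.5] -/
def emeryCellWeight (lam : ℝ) (s : Finset (Orb (PolySite (halfOpenRect liebPeriods)))) : ℂ :=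
  ((1 - lam : ℝ) : ℂ) * (if s = ∅ then 1 else 0) + (lam : ℂ) * (if s = emeryPhysOrbs then 1 else 0)

/-- **The witness cell density matrix** `ρ_λ = diag p_λ = (1−λ)|∅⟩⟨∅| + λ|T⟩⟨T|`. [cite: ArakiMoriya2003, §4.1 Def. 4.5] -/
def emeryCellDensityMatrix (lam : ℝ) : FermionOp (halfOpenRect liebPeriods) :=
  diagonal (emeryCellWeight lam)

/-- Sums against the witness weight: `Σ_s f(s) p_λ(s) = (1−λ) f(∅) + λ f(T)`. [folklore] -/
private theorem sum_mul_emeryCellWeight (f : Finset (Orb (PolySite (halfOpenRect liebPeriods))) → ℂ) (lam : ℝ) :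
    ∑ s, f s * emeryCellWeight lam s = ((1 - lam : ℝ) : ℂ) * f ∅ + (lam : ℂ) * f emeryPhysOrbs :=
  sum_mul_twoPoint f _ _ _ _

/-- The witness is even. [cite: ArakiMoriya2003, §4.1 Def. 4.2] -/
theorem parityAut_emeryCellDensityMatrix (lam : ℝ) : parityAut (emeryCellDensityMatrix lam) = emeryCellDensityMatrix lam :=
  parityAut_diagonal _

/-- The witness has unit trace. [cite: ArakiMoriya2003, §4.1 Def. 4.5] -/
theorem trace_emeryCellDensityMatrix (lam : ℝ) : (emeryCellDensityMatrix lam).trace = 1 := by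
  rw [emeryCellDensityMatrix, trace_diagonal]
  have h := sum_mul_emeryCellWeight (fun _ => 1) lam
  simp only [one_mul, mul_one] at h
  rw [h]
  push_cast
  ring

/-- The witness is positive for `0 ≤ λ ≤ 1`. [cite: ArakiMoriya2003, §4.1 Def. 4.5] -/
theorem posSemidef_emeryCellDensityMatrix {lam : ℝ} (h0 : 0 ≤ lam) (h1 : lam ≤ 1) : (emeryCellDensityMatrix lam).PosSemidef := by
  rw [emeryCellDensityMatrix]
  refine posSemidef_diagonal_iff.2 fun s => ?_
  unfold emeryCellWeight
  by_cases hs : s = ∅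
  · rw [if_pos hs, if_neg (fun h => emeryPhysOrbs_ne_empty (h.symm.trans hs)), mul_one, mul_zero, add_zero]
    exact Complex.zero_le_real.2 (by linarith)
  · rw [if_neg hs, mul_zero, zero_add]
    by_cases hT : s = emeryPhysOrbs
    · rw [if_pos hT, mul_one]; exact Complex.zero_le_real.2 h0
    · rw [if_neg hT, mul_zero]

/-- Trace of an occupation-diagonal observable against the witness: `tr(diag f · ρ_λ) = (1−λ) f(∅) + λ f(T)`. [folklore] -/
private theorem trace_diagonal_mul_emeryCellDensityMatrix (f : Finset (Orb (PolySite (halfOpenRect liebPeriods))) → ℂ) (lam : ℝ) :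
    (diagonal f * emeryCellDensityMatrix lam).trace = ((1 - lam : ℝ) : ℂ) * f ∅ + (lam : ℂ) * f emeryPhysOrbs := by
  rw [emeryCellDensityMatrix, diagonal_mul_diagonal, trace_diagonal]
  exact sum_mul_emeryCellWeight f lam

/-- **No particle on the dummy site**: `tr((n_{(1,1)↑} + n_{(1,1)↓}) ρ_λ) = 0`. [cite: PavariniEtAl2001, eq. (1)] -/
theorem trace_nAt_dummy_mul_emeryCellDensityMatrix (lam : ℝ) :
    ((nAt dummySite InfVolFermionState.dummySite_mem_halfOpenRect 0 + nAt dummySite InfVolFermionState.dummySite_mem_halfOpenRect 1) *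
        emeryCellDensityMatrix lam).trace = 0 := by
  rw [nAt, nAt, ← numberAt_orb, ← numberAt_orb, numberAt_eq_diagonal, numberAt_eq_diagonal, diagonal_add,
    trace_diagonal_mul_emeryCellDensityMatrix]
  simp only [Finset.notMem_empty, if_false, add_zero, mul_zero,
    if_neg (orb_dummy_notMem_emeryPhysOrbs 0), if_neg (orb_dummy_notMem_emeryPhysOrbs 1)]

/-- **Particle number of the witness**: `tr(N ρ_λ) = 6λ`. [cite: ArakiMoriya2003, §4.1 (number operators)] -/
theorem trace_totalNumber_mul_emeryCellDensityMatrix (lam : ℝ) :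
    ((totalNumber : FermionOp (halfOpenRect liebPeriods)) * emeryCellDensityMatrix lam).trace = 6 * (lam : ℂ) := by
  rw [totalNumber_eq_diagonal_card, trace_diagonal_mul_emeryCellDensityMatrix, Finset.card_empty, card_emeryPhysOrbs]
  push_cast
  ring

end Witness

/-! ### §4 Nonemptiness of the variational class, exactly on `0 ≤ ρ ≤ 3/2` -/

namespace InfVolFermionState

/-- **The periodic product of the witness is a member of `emeryStates (3λ/2)`** (`0 ≤ λ ≤ 1`). [cite: BratteliRobinsonII1997, Thm. 6.2.40] -/
theorem rectTilingState_emeryCellDensityMatrix_mem {lam : ℝ} (h0 : 0 ≤ lam) (h1 : lam ≤ 1) :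
    rectTilingState liebPeriods (emeryCellDensityMatrix lam) (parityAut_emeryCellDensityMatrix lam) (posSemidef_emeryCellDensityMatrix h0 h1)
        (trace_emeryCellDensityMatrix lam) ∈ emeryStates (3 * lam / 2) := by
  refine rectTilingState_mem_emeryStates _ _ _ _ ?_ ?_
  · rw [trace_nAt_dummy_mul_emeryCellDensityMatrix, Complex.zero_re]
  · rw [trace_totalNumber_mul_emeryCellDensityMatrix]
    rw [show ((6 : ℂ) * (lam : ℂ)) = (((6 * lam : ℝ)) : ℂ) by push_cast; ring, Complex.ofReal_re]
    ring

/-- **THE DUMMY-FREE `2×2`-PERIODIC CLASS IS NONEMPTY at every cell filling `0 ≤ ρ ≤ 3/2`** (filling `4ρ ∈ [0, 6]` per `CuO₂` unit):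
witness `⊗_v ρ_λ` with `λ = 2ρ/3`. Discharges the hypothesis `(emeryStates ρ).Nonempty` of every three-band floor / Lipschitz / cluster law.
[cite: ArakiMoriya2003, §11.1 Theorem 11.2] [cite: BratteliRobinsonII1997, Thm. 6.2.40] -/
theorem emeryStates_nonempty {ρ : ℝ} (hρ0 : 0 ≤ ρ) (hρ1 : ρ ≤ 3 / 2) : (emeryStates ρ).Nonempty := by
  have h0 : 0 ≤ 2 * ρ / 3 := by positivity
  have h1 : 2 * ρ / 3 ≤ 1 := by linarith
  have h := rectTilingState_emeryCellDensityMatrix_mem h0 h1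
  rw [show 3 * (2 * ρ / 3) / 2 = ρ by ring] at h
  exact ⟨_, h⟩

/-- **Conversely, a member forces `0 ≤ ρ ≤ 3/2`**: the cell filling of a dummy-free `2×2`-periodic state averages three one-site
densities in `[0, 2]` and one zero over four sites. [cite: ArakiMoriya2003, §4.1] -/
theorem emeryStates_subset_range {ρ : ℝ} {ω : InfVolFermionState 2} (hω : ω ∈ emeryStates ρ) : 0 ≤ ρ ∧ ρ ≤ 3 / 2 := by
  obtain ⟨-, hdummy, hfill⟩ := hω
  rw [InfVolFermionState.cellFilling, card_cell_liebPeriods'] at hfill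
  have hsplit := Finset.add_sum_erase (Finset.univ : Finset (Cell liebPeriods)) (fun c => (ω.shift (cellPos c)).density)
    (Finset.mem_univ (fun i => Fin.last (liebPeriods i)))
  have hD : (ω.shift (cellPos (fun i => Fin.last (liebPeriods i) : Cell liebPeriods))).density = 0 := by
    rw [cellPos_dummy]; exact hdummy
  have hcard : #((Finset.univ : Finset (Cell liebPeriods)).erase (fun i => Fin.last (liebPeriods i))) = 3 := by
    rw [Finset.card_erase_of_mem (Finset.mem_univ _), Finset.card_univ, card_cell_liebPeriods']
  have hle : ∑ c ∈ (Finset.univ : Finset (Cell liebPeriods)).erase (fun i => Fin.last (liebPeriods i)), (ω.shift (cellPos c)).density ≤ 3 * 2 := by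
    have h := Finset.sum_le_card_nsmul ((Finset.univ : Finset (Cell liebPeriods)).erase (fun i => Fin.last (liebPeriods i)))
      (fun c => (ω.shift (cellPos c)).density) 2 (fun c _ => (ω.shift (cellPos c)).density_le_two)
    rw [hcard, nsmul_eq_mul] at h
    push_cast at h
    exact h
  have hge : 0 ≤ ∑ c ∈ (Finset.univ : Finset (Cell liebPeriods)).erase (fun i => Fin.last (liebPeriods i)), (ω.shift (cellPos c)).density :=
    Finset.sum_nonneg fun c _ => (ω.shift (cellPos c)).density_nonneg
  rw [hD, zero_add] at hsplit
  rw [hsplit] at hle hge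
  constructor
  · rw [← hfill]; exact mul_nonneg (inv_nonneg.2 (Nat.cast_nonneg _)) hge
  · rw [← hfill, Nat.cast_ofNat, inv_mul_le_iff₀ (by norm_num : (0 : ℝ) < 4)]; linarith

/-- **`emeryStates ρ` is nonempty iff `0 ≤ ρ ≤ 3/2`.** [cite: ArakiMoriya2003, §11.1 Theorem 11.2] -/
theorem emeryStates_nonempty_iff (ρ : ℝ) : (emeryStates ρ).Nonempty ↔ 0 ≤ ρ ∧ ρ ≤ 3 / 2 :=
  ⟨fun ⟨_, hω⟩ => emeryStates_subset_range hω, fun h => emeryStates_nonempty h.1 h.2⟩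

end InfVolFermionState

/-- **JOINT LIPSCHITZ BOUND, hypothesis-free form**: for `0 ≤ ρ ≤ 3/2`, `|e(θ, ρ) − e(θ', ρ)| ≤ Σ_a C_a|θ_a − θ'_a|`
(`C = emeryConstants`). [cite: Israel1979, Thm. I.3.4] -/
theorem abs_emeryEnergyDensity_sub_le' {ρ : ℝ} (hρ0 : 0 ≤ ρ) (hρ1 : ρ ≤ 3 / 2) (θ θ' : Fin 14 → ℝ) :
    |emeryEnergyDensity θ ρ - emeryEnergyDensity θ' ρ| ≤ ∑ a, emeryConstants a * |θ a - θ' a| :=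
  abs_emeryEnergyDensity_sub_le (InfVolFermionState.emeryStates_nonempty hρ0 hρ1) θ θ'

end Literature.MathematicalPhysics.QuantumLattice

end
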